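import Summits.Ventures.PercRepro.C026ThreePlanes
import Summits.Ventures.PercRepro.C026HubPairGadget

/-!
# Bit-planes for the 6-vertex gadget, I: the transposition to `PairModel` (p5, gen 13)

Bit `s` of each plane of `C026ThreePlanes` is the Model's evaluator (`botB`, `o1B`, `o2B`, `badB`) on the
rows of the state `s` (`oRowsAt s`, `cRowsAt s`); so the tree's `isBot_iff_botB` etc. read the planes.
-/

namespace PercRepro

namespace Plane6
open PairModel

/-! ### Planes -/

/-- The input plane at width `2^n` is below `2^(2^n)`. -/
theorem inP_lt (i : ℕ) : ∀ n, inP i n < 2 ^ (2 ^ n) := by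
  intro n
  induction n with
  | zero => simp [inP]
  | succ n ih =>
    simp only [inP]
    apply Nat.lt_pow_two_of_testBit
    intro j hj
    rw [Nat.testBit_or, Nat.testBit_shiftLeft]
    have h1 : (inP i n).testBit j = false :=
      Nat.testBit_lt_two_pow (lt_of_lt_of_le ih (Nat.pow_le_pow_right (by norm_num) (by
        calc 2 ^ n ≤ 2 ^ (n + 1) := Nat.pow_le_pow_right (by norm_num) (by omega)
          _ ≤ j := hj)))
    have h2 : (if i = n then 2 ^ 2 ^ n - 1 else inP i n).testBit (j - 2 ^ n) = false := by
      have hlt : (if i = n then 2 ^ 2 ^ n - 1 else inP i n) < 2 ^ 2 ^ n := by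
        split_ifs
        · exact Nat.sub_lt (by positivity) (by norm_num)
        · exact ih
      apply Nat.testBit_lt_two_pow
      calc (if i = n then 2 ^ 2 ^ n - 1 else inP i n) < 2 ^ 2 ^ n := hlt
        _ ≤ 2 ^ (j - 2 ^ n) := Nat.pow_le_pow_right (by norm_num) (by
            rw [pow_succ] at hj; omega)
    simp [h1, h2]

/-- Bit `s < 2^n` of the input plane of bit `i` is bit `i` of `s`. -/
theorem testBit_inP (i : ℕ) : ∀ n s, s < 2 ^ n → (inP i n).testBit s = s.testBit i := by
  intro n
  induction n with
  | zero =>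
    intro s hs
    have : s = 0 := by simpa using hs
    subst this
    simp [inP]
  | succ n ih =>
    intro s hs
    simp only [inP, Nat.testBit_or, Nat.testBit_shiftLeft]
    rcases Nat.lt_or_ge s (2 ^ n) with h | h
    · have hlow : (inP i n).testBit s = s.testBit i := ih s h
      have hhi : decide (s ≥ 2 ^ n) = false := by simp; omega
      simp [hlow, hhi]
    · -- s = 2^n + t with t < 2^n
      obtain ⟨t, rfl⟩ : ∃ t, s = 2 ^ n + t := ⟨s - 2 ^ n, by omega⟩
      have ht : t < 2 ^ n := by rw [pow_succ] at hs; omega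
      have h0 : (inP i n).testBit (2 ^ n + t) = false :=
        Nat.testBit_lt_two_pow (lt_of_lt_of_le (inP_lt i n) (Nat.pow_le_pow_right (by norm_num) (by omega)))
      have hge : decide (2 ^ n + t ≥ 2 ^ n) = true := by simp
      simp only [h0, hge, Bool.false_or, Bool.true_and, Nat.add_sub_cancel_left]
      by_cases hin : i = n
      · subst hin
        rw [if_pos rfl, Nat.testBit_two_pow_sub_one, Nat.testBit_two_pow_add_eq]
        simp [Nat.testBit_lt_two_pow ht, ht]
      · rw [if_neg hin, ih t ht]
        rcases Nat.lt_or_ge i n with hlt | hge'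
        · exact (Nat.testBit_two_pow_add_gt hlt t).symm
        · have hi : n < i := lt_of_le_of_ne hge' (Ne.symm hin)
          have hl : t < 2 ^ i := lt_of_lt_of_le ht (Nat.pow_le_pow_right (by norm_num) (by omega))
          have hl2 : 2 ^ n + t < 2 ^ i := by
            calc 2 ^ n + t < 2 ^ n + 2 ^ n := by omega
              _ = 2 ^ (n + 1) := by ring
              _ ≤ 2 ^ i := Nat.pow_le_pow_right (by norm_num) (by omega)
          rw [Nat.testBit_lt_two_pow hl, Nat.testBit_lt_two_pow hl2]

/-- Bit `s` of the input plane `I i` is bit `i` of the state `s`. -/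
theorem testBit_I {s : ℕ} (hs : s < NS) (i : ℕ) : (I i).testBit s = s.testBit i :=
  testBit_inP i 24 s hs

/-- Every bit of the all-ones plane is set (below `NS`). -/
theorem testBit_ones {s : ℕ} (hs : s < NS) : ones.testBit s = true := by
  simp [ones, Nat.testBit_two_pow_sub_one, hs]

/-- Plane negation negates the bit (below `NS`). -/
theorem testBit_notP {s : ℕ} (hs : s < NS) (x : ℕ) : (notP x).testBit s = !x.testBit s := by
  simp [notP, Nat.testBit_xor, testBit_ones hs]

/-! ### Classes, rows of the state -/

/-- The open rows of the state `s`. -/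
def oRowsAt (s : ℕ) : Rows := (List.range 6).map fun i => maskOf 6 (oBit s i)

/-- The closed rows of the state `s`. -/
def cRowsAt (s : ℕ) : Rows := (List.range 6).map fun i => maskOf 6 (cBit s i)

/-- The rows of a plane-valued adjacency at the state `s`. -/
def PRows.at (R : PRows) (s : ℕ) : Rows := (List.range 6).map fun i => maskOf 6 fun j => (R i j).testBit s

/-- The open rows of all states, at the state `s`, are the open rows of `s`. -/
theorem Orows_at {s : ℕ} (hs : s < NS) : Orows.at s = oRowsAt s := by
  unfold PRows.at oRowsAt
  apply List.map_congr_left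
  intro i _
  congr 1
  funext j
  simp only [Orows, oBit]
  cases cls i j <;> simp [testBit_I hs]

/-- The closed rows of all states, at the state `s`, are the closed rows of `s`. -/
theorem Crows_at {s : ℕ} (hs : s < NS) : Crows.at s = cRowsAt s := by
  unfold PRows.at cRowsAt
  apply List.map_congr_left
  intro i _
  congr 1
  funext j
  simp only [Crows, cBit]
  cases cls i j <;> simp [testBit_I hs]

/-- An entry of the rows of a plane-valued adjacency at the state `s`. -/
theorem adj_at (R : PRows) (s : ℕ) {i : ℕ} (hi : i < 6) (j : ℕ) :
    adj (R.at s) i j = (decide (j < 6) && (R i j).testBit s) := by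
  simp [adj, PRows.at, row_map_range hi, testBit_maskOf]

/-! ### Vertex sets -/

/-- The plane of `w < 6` in `V6.ofFn f` is `f w`. -/
theorem V6.get_ofFn (f : ℕ → ℕ) {w : ℕ} (hw : w < 6) : (V6.ofFn f).get w = f w := by
  interval_cases w <;> rfl

/-- The plane of `w ≥ 6` is `0`. -/
theorem V6.get_of_ge (S : V6) {w : ℕ} (hw : 6 ≤ w) : S.get w = 0 := by
  unfold V6.get
  split <;> omega

/-- The bitmask of the vertex set at the state `s`. -/
def V6.at (S : V6) (s : ℕ) : ℕ := maskOf 6 fun w => (S.get w).testBit s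

/-- Bit `w` of the bitmask at `s` is bit `s` of the plane of `w` (for `w < 6`). -/
theorem V6.testBit_at (S : V6) (s w : ℕ) : (S.at s).testBit w = (decide (w < 6) && (S.get w).testBit s) := by
  simp [V6.at, testBit_maskOf]

/-- The bitmask at a state is below `2^6`. -/
theorem V6.at_lt (S : V6) (s : ℕ) : S.at s < 2 ^ 6 := by
  apply Nat.lt_pow_two_of_testBit
  intro j hj
  rw [V6.testBit_at]
  simp; omega

/-! ### The transposed model -/

/-! ### Transposition lemmas -/

/-- Bit `s` of the transposed neighbour set is the model's `nbr` at the state `s`. -/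
theorem testBit_nbrP (R : PRows) (S : V6) (s : ℕ) :
    ∀ n, n ≤ 6 → ∀ w, w < 6 → ((nbrP n R S).get w).testBit s = (nbr n (R.at s) (S.at s)).testBit w := by
  intro n
  induction n with
  | zero => intro _ w hw; simp [nbrP, nbr, V6.get_ofFn _ hw]
  | succ n ih =>
    intro hn w hw
    have hn' : n < 6 := by omega
    simp only [nbrP, nbr, V6.get_ofFn _ hw, Nat.testBit_or, Nat.testBit_and, ih (by omega) w hw,
      V6.testBit_at, hn', decide_true, Bool.true_and]
    have hrow : (row (R.at s) n).testBit w = (R n w).testBit s := by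
      have := adj_at R s hn' w
      simp [adj, hw] at this
      exact this
    cases (S.get n).testBit s <;> simp [hrow]

/-- The transposed round at a state is the model's round. -/
theorem at_stepP (R : PRows) (S : V6) (s : ℕ) : (stepP 6 R S).at s = step 6 (R.at s) (S.at s) := by
  apply Nat.eq_of_testBit_eq
  intro w
  rw [V6.testBit_at]
  rcases Nat.lt_or_ge w 6 with hw | hw
  · simp only [stepP, V6.get_ofFn _ hw, Nat.testBit_or, step, testBit_nbrP R S s 6 le_rfl w hw, hw,
      decide_true, Bool.true_and, V6.testBit_at]
  · have h1 : decide (w < 6) = false := by simp; omega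
    simp only [h1, Bool.false_and]
    symm
    apply Nat.testBit_lt_two_pow
    calc step 6 (R.at s) (S.at s) < 2 ^ 6 := by
          apply Nat.lt_pow_two_of_testBit
          intro j hj
          rw [Bool.eq_false_iff, Ne, testBit_step]
          rintro (h | ⟨i, hi, _, ha⟩)
          · have := V6.testBit_at S s j
            simp [h] at this; omega
          · have := adj_at R s hi j
            rw [ha] at this
            simp at this; omega
      _ ≤ 2 ^ w := Nat.pow_le_pow_right (by norm_num) hw

/-- The transposed iteration at a state is the model's iteration. -/
theorem at_iterP (R : PRows) (s : ℕ) : ∀ k (S : V6), (iterP 6 R k S).at s = (step 6 (R.at s))^[k] (S.at s) := by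
  intro k
  induction k with
  | zero => intro S; rfl
  | succ k ih => intro S; rw [iterP, ih, Function.iterate_succ_apply, at_stepP]

/-- The singleton vertex set at a state is the bit `2^i`. -/
theorem at_unit {s : ℕ} (hs : s < NS) {i : ℕ} (hi : i < 6) : (unit i).at s = 2 ^ i := by
  apply Nat.eq_of_testBit_eq
  intro w
  rw [V6.testBit_at, Nat.testBit_two_pow]
  rcases Nat.lt_or_ge w 6 with hw | hw
  · simp only [unit, V6.get_ofFn _ hw, hw, decide_true, Bool.true_and]
    by_cases h : w = i
    · subst h; simp [testBit_ones hs]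
    · simp [h]; intro h'; exact absurd h'.symm h
  · have h1 : decide (w < 6) = false := by simp; omega
    have h2 : decide (i = w) = false := by simp; omega
    simp [h1, h2]

/-- The transposed reachable set at a state is the model's `reach`. -/
theorem at_reachP (R : PRows) {s : ℕ} (hs : s < NS) {i : ℕ} (hi : i < 6) :
    (reachP 6 R i).at s = reach 6 (R.at s) i := by
  rw [reachP, at_iterP, at_unit hs hi]; rfl

/-- Bit `s` of the transposed reachability is the model's `reachB` at the state `s`. -/
theorem testBit_reachBP (R : PRows) {s : ℕ} (hs : s < NS) (i j : ℕ) (hi : i < 6) (hj : j < 6) :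
    (reachBP 6 R i j).testBit s = reachB 6 (R.at s) i j := by
  have := V6.testBit_at (reachP 6 R i) s j
  rw [at_reachP R hs hi] at this
  simp [reachBP, reachB, this, hj]

/-- The transposed closure rows at a state are the model's `closureRows`. -/
theorem at_closureRowsP (O : PRows) {s : ℕ} (hs : s < NS) :
    (closureRowsP 6 O).at s = closureRows 6 (O.at s) := by
  unfold PRows.at closureRows
  apply List.map_congr_left
  intro i hi
  have hi' : i < 6 := by simpa using hi
  apply Nat.eq_of_testBit_eq
  intro j
  rw [testBit_maskOf, testBit_maskOf]
  by_cases hj : j < 6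
  · simp only [hj, decide_true, Bool.true_and, closureRowsP]
    exact testBit_reachBP O hs i j hi' hj
  · simp [hj]

/-- Bit `s` of the transposed H-adjacency is the model's `hBit` at the state `s`. -/
theorem testBit_hBitP (O C Ocl : PRows) (M : V6) {s : ℕ} (hs : s < NS) {i j : ℕ} (hi : i < 6) (hj : j < 6) :
    (hBitP O C Ocl M i j).testBit s = hBit (O.at s) (C.at s) (Ocl.at s) (M.at s) i j := by
  unfold hBitP hBit
  by_cases hij : i = j
  · subst hij; simp
  · rw [if_neg hij]
    have hne : (i != j) = true := by simpa using hij
    simp only [hne, Bool.true_and, Nat.testBit_or, Nat.testBit_and, Nat.testBit_xor, testBit_notP hs,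
      V6.testBit_at, hi, hj, decide_true, adj_at O s hi j, adj_at C s hi j, adj_at Ocl s hi j]

/-- The transposed H-rows at a state are the model's `hRows`. -/
theorem at_hRowsP (O C Ocl : PRows) (M : V6) {s : ℕ} (hs : s < NS) :
    (hRowsP 6 O C Ocl M).at s = hRows 6 (O.at s) (C.at s) (Ocl.at s) (M.at s) := by
  unfold PRows.at hRows
  apply List.map_congr_left
  intro i hi
  have hi' : i < 6 := by simpa using hi
  apply Nat.eq_of_testBit_eq
  intro j
  rw [testBit_maskOf, testBit_maskOf]
  by_cases hj : j < 6
  · simp only [hj, decide_true, Bool.true_and, hRowsP, hi', and_self, if_true]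
    exact testBit_hBitP O C Ocl M hs hi' hj
  · simp [hj]

/-- The transposed deletion at a state is the model's `avoid`. -/
theorem at_avoidP (H : PRows) (X : V6) {s : ℕ} (hs : s < NS) :
    (avoidP 6 H X).at s = avoid 6 (H.at s) (X.at s) := by
  unfold avoid
  show (List.range 6).map _ = (List.range 6).map _
  apply List.map_congr_left
  intro i hi
  have hi' : i < 6 := by simpa using hi
  apply Nat.eq_of_testBit_eq
  intro j
  rw [testBit_maskOf, testBit_maskOf]
  by_cases hj : j < 6
  · simp only [hj, decide_true, Bool.true_and, avoidP, hi', and_self, if_true, Nat.testBit_and,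
      testBit_notP hs, V6.testBit_at, adj_at H s hi' j]
  · simp [hj]

/-- The empty vertex set at a state is the bitmask `0`. -/
theorem at_zero (s : ℕ) : (V6.ofFn fun _ => 0).at s = 0 := by
  apply Nat.eq_of_testBit_eq
  intro w
  rw [V6.testBit_at, Nat.zero_testBit]
  by_cases hw : w < 6
  · simp [V6.get_ofFn _ hw]
  · simp [hw]

/-- The transposed H-rows of the state at a state are the model's `hOf`. -/
theorem at_hOfP (O C : PRows) {s : ℕ} (hs : s < NS) : (hOfP 6 O C).at s = hOf 6 (O.at s) (C.at s) := by
  rw [hOfP, hOf, at_hRowsP O C _ _ hs, at_closureRowsP O hs, at_reachP O hs (by norm_num)]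

/-- Bit `s` of the transposed `bot` is the model's `botB` at the state `s`. -/
theorem testBit_botP (O : PRows) {s : ℕ} (hs : s < NS) : (botP 6 O).testBit s = botB 6 (O.at s) := by
  simp only [botP, botB, Nat.testBit_and, testBit_notP hs,
    testBit_reachBP O hs 0 1 (by norm_num) (by norm_num), testBit_reachBP O hs 0 2 (by norm_num) (by norm_num),
    testBit_reachBP O hs 1 2 (by norm_num) (by norm_num)]

/-- Bit `s` of the transposed `o1` is the model's `o1B` at the state `s`. -/
theorem testBit_o1P (O C : PRows) {s : ℕ} (hs : s < NS) :
    (o1P 6 O C).testBit s = o1B 6 (O.at s) (C.at s) := by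
  rw [o1P, o1B, testBit_reachBP _ hs 2 0 (by norm_num) (by norm_num), at_avoidP _ _ hs, at_hOfP O C hs,
    at_reachP O hs (by norm_num)]

/-- Bit `s` of the transposed `o2` is the model's `o2B` at the state `s`. -/
theorem testBit_o2P (O C : PRows) {s : ℕ} (hs : s < NS) :
    (o2P 6 O C).testBit s = o2B 6 (O.at s) (C.at s) := by
  rw [o2P, o2B, testBit_reachBP _ hs 2 1 (by norm_num) (by norm_num), at_avoidP _ _ hs, at_hOfP O C hs,
    at_reachP O hs (by norm_num)]

/-- Bit `s` of the transposed `BAD` is the model's `badB` at the state `s`. -/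
theorem testBit_badP (O C : PRows) {s : ℕ} (hs : s < NS) :
    (badP 6 O C).testBit s = badB 6 (O.at s) (C.at s) := by
  rw [badP, badB, testBit_reachBP _ hs 0 1 (by norm_num) (by norm_num), at_avoidP _ _ hs, at_hOfP O C hs,
    at_zero]

/-! ### The events of the 6-vertex gadget, for all states at once -/

/-- **`bot` of the state `s`** is the model's `botB` on the rows of `s`. -/
theorem testBit_bot {s : ℕ} (hs : s < NS) : bot.testBit s = botB 6 (oRowsAt s) := by
  rw [bot, testBit_botP _ hs, Orows_at hs]

/-- **`o1` of the state `s`** is the model's `o1B` on the rows of `s`. -/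
theorem testBit_o1 {s : ℕ} (hs : s < NS) : o1.testBit s = o1B 6 (oRowsAt s) (cRowsAt s) := by
  rw [o1, testBit_o1P _ _ hs, Orows_at hs, Crows_at hs]

/-- **`o2` of the state `s`** is the model's `o2B` on the rows of `s`. -/
theorem testBit_o2 {s : ℕ} (hs : s < NS) : o2.testBit s = o2B 6 (oRowsAt s) (cRowsAt s) := by
  rw [o2, testBit_o2P _ _ hs, Orows_at hs, Crows_at hs]

/-- **`BAD` of the state `s`** is the model's `badB` on the rows of `s`. -/
theorem testBit_BAD {s : ℕ} (hs : s < NS) : BAD.testBit s = badB 6 (oRowsAt s) (cRowsAt s) := by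
  rw [BAD, testBit_badP _ _ hs, Orows_at hs, Crows_at hs]


end Plane6

end PercRepro
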